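import Mathlib
import HarnessLib

/-!
# Boltzmann's fourth virial coefficient of hard spheres (`D = 3`), as printed by Lyberg (2005)
# and Clisby–McCoy (2004)

Topic `Literature/MathematicalPhysics/StatisticalMechanics`; namespace
`Literature.MathematicalPhysics.StatisticalMechanics`. A NAMED FACT (D-0014, statement only),
vendored for route `Summit.KontsevichZagierPeriods.KontsevichZagierPeriods.Theses.HardSphereVirial`
(grounds `…HardSphereVirial.StarFourSphere`, and the value side of `RingFourSphere`,
`DiamondFourSphere`): the closed form of `B₄/B₂³` for hard spheres in three dimensions.

**What is printed.** I. Lyberg, *The fourth virial coefficient of a fluid of hard spheres in odd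
dimensions*, J. Stat. Phys. 119 (2005) 747–764 [Lyberg2005] (held text arXiv:cond-mat/0410080,
§1 read): the Mayer form of the fourth virial coefficient

> `B₄ = −(1/8)·[complete star] − (3/4)·[diamond] − (3/8)·[ring]`  (§1, display (5)),

each diagram denoting the cluster integral `∫∫∫ ∏_{bonds ij} f(r_ij) d^D r₂ d^D r₃ d^D r₄`
(`r₁` fixed; §1, displays (2)–(5)), with the hard-sphere Mayer function
`f(r) = −1` if `r < σ`, `0` if `r ≥ σ`, "From now on we let `σ = 1`" (display (6)),
`B₂ = π^{D/2} / (2 Γ(D/2 + 1))` (display (7), `= 2π/3` for `D = 3`), and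

> "Boltzmann's result was
> `B₄/B₂³ = 2707/4480 + (219/2240)·(√2/π) − (4131/4480)·(arccos(1/3)/π)`.
> This result was confirmed in 1952 by Nijboer and van Hove [N/H] using what is called the two
> center formalism." (§1, the display following (12); [B] = Boltzmann 1899,
> [N/H] = [NijboerVanhove1952]).

The same value is printed by N. Clisby, B. M. McCoy, *Analytic calculation of `B₄` for hard
spheres in even dimensions*, J. Stat. Phys. 114 (2004) 1343–1361 [ClisbyMccoy2004], §1:
"`B₄/B₂³ = 219√2/(2240π) − 89/280 + (4131/(2240π))·arctan √2` for `D = 3`" — equal to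
Boltzmann's form because `arccos(1/3) = π − 2 arctan √2` and `2707/4480 − 4131/4480 = −89/280`.

**Rendering.** For the hard-sphere `f` the integrand `∏_{bonds} f(r_ij)` of a Mayer diagram `G`
with edge set `E` is `(−1)^{|E|}` times the indicator of the configuration set
`C_G = {(r₂, r₃, r₄) ∈ (ℝ³)³ : |r_i − r_j| < 1 for ij ∈ E}` (`r₁ = 0`), so
`[ring] = vol C_{C₄}` (`|E| = 4`, bonds 12, 23, 34, 41), `[diamond] = −vol C_◇` (`|E| = 5`,
ring plus the chord 13) and `[complete star] = vol C_{K₄}` (`|E| = 6`). The sets are written in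
the coordinates `x : Fin 9 → ℝ`, `r₂ = (x 0, x 1, x 2)`, `r₃ = (x 3, x 4, x 5)`,
`r₄ = (x 6, x 7, x 8)` — literally the domains of the route's items `RingFourSphere`,
`DiamondFourSphere`, `StarFourSphere` — and their volumes are Lebesgue volumes
(`MeasureTheory.volume`, `.toReal`; all three sets are bounded and open). The fact states the
printed identity with `B₂³ = (2π/3)³` substituted:
`(−(1/8)·vol C_{K₄} + (3/4)·vol C_◇ − (3/8)·vol C_{C₄}) / (2π/3)³ = 2707/4480 + …`.
For an integrand-`1` Kontsevich–Zagier representation `r` with `r.domain = C_G` one has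
`r.value = (volume C_G).toReal` (`MeasureTheory.setIntegral_const`), which is how the route's
items consume it. NOT vendored here: the separate values of the three diagrams (Lyberg's and
Clisby–McCoy's tables are not reproduced in the held text), the even-dimensional value
`2 − 9√3/(2π) + 10/π²` (`D = 2`, Rowlinson 1964 / Hemmer 1964, same display of [ClisbyMccoy2004];
left to the grounder of `StarFourDisc`), and `B₂`, `B₃` in general `D`.

## References

* [Lyberg2005] I. Lyberg, The fourth virial coefficient of a fluid of hard spheres in odd
  dimensions, J. Stat. Phys. 119 (2005) 747–764, §1 (displays (2)–(7) and Boltzmann's formula).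
* [ClisbyMccoy2004] N. Clisby, B. M. McCoy, Analytic calculation of B₄ for hard spheres in even
  dimensions, J. Stat. Phys. 114 (2004) 1343–1361, §1 (the display giving `B₄/B₂³` for `D = 2, 3`).
* [NijboerVanhove1952] B. R. A. Nijboer, L. Van Hove, Radial distribution function of a gas of hard
  spheres and the superposition approximation, Phys. Rev. 85 (1952) 777–783.
-/

noncomputable section

open MeasureTheory

namespace Literature.MathematicalPhysics.StatisticalMechanics

/-- Configuration set of the **ring** Mayer diagram of `B₄` for hard spheres of diameter `1` in
`ℝ³` (bonds 12, 23, 34, 41; `r₁ = 0`, `r₂ = (x 0, x 1, x 2)`, `r₃ = (x 3, x 4, x 5)`,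
`r₄ = (x 6, x 7, x 8)`). [cite: Lyberg2005, §1 displays (5)–(6)] -/
def hardSphereRingFour : Set (Fin 9 → ℝ) :=
  {x | x 0 ^ 2 + x 1 ^ 2 + x 2 ^ 2 < 1 ∧ (x 0 - x 3) ^ 2 + (x 1 - x 4) ^ 2 + (x 2 - x 5) ^ 2 < 1 ∧
    (x 3 - x 6) ^ 2 + (x 4 - x 7) ^ 2 + (x 5 - x 8) ^ 2 < 1 ∧ x 6 ^ 2 + x 7 ^ 2 + x 8 ^ 2 < 1}

/-- Configuration set of the **diamond** (ring plus the chord 13) Mayer diagram of `B₄` for hard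
spheres of diameter `1` in `ℝ³` (bonds 12, 13, 23, 34, 41). [cite: Lyberg2005, §1 displays (5)–(6)] -/
def hardSphereDiamondFour : Set (Fin 9 → ℝ) :=
  {x | x 0 ^ 2 + x 1 ^ 2 + x 2 ^ 2 < 1 ∧ x 3 ^ 2 + x 4 ^ 2 + x 5 ^ 2 < 1 ∧
    (x 0 - x 3) ^ 2 + (x 1 - x 4) ^ 2 + (x 2 - x 5) ^ 2 < 1 ∧
    (x 3 - x 6) ^ 2 + (x 4 - x 7) ^ 2 + (x 5 - x 8) ^ 2 < 1 ∧ x 6 ^ 2 + x 7 ^ 2 + x 8 ^ 2 < 1}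

/-- Configuration set of the **complete star** Mayer diagram of `B₄` for hard spheres of diameter
`1` in `ℝ³` (all six bonds). [cite: Lyberg2005, §1 displays (5)–(6)] -/
def hardSphereStarFour : Set (Fin 9 → ℝ) :=
  {x | x 0 ^ 2 + x 1 ^ 2 + x 2 ^ 2 < 1 ∧ x 3 ^ 2 + x 4 ^ 2 + x 5 ^ 2 < 1 ∧
    x 6 ^ 2 + x 7 ^ 2 + x 8 ^ 2 < 1 ∧ (x 0 - x 3) ^ 2 + (x 1 - x 4) ^ 2 + (x 2 - x 5) ^ 2 < 1 ∧
    (x 0 - x 6) ^ 2 + (x 1 - x 7) ^ 2 + (x 2 - x 8) ^ 2 < 1 ∧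
    (x 3 - x 6) ^ 2 + (x 4 - x 7) ^ 2 + (x 5 - x 8) ^ 2 < 1}

/-- **Boltzmann 1899 / Nijboer–van Hove 1952 (as printed by Lyberg 2005, §1, and Clisby–McCoy
2004, §1): the fourth virial coefficient of hard spheres in three dimensions.** With
`B₄ = −(1/8)·[complete star] − (3/4)·[diamond] − (3/8)·[ring]` (Mayer), the hard-sphere Mayer
function `f = −𝟙_{r<1}` (so `[ring] = vol C_{C₄}`, `[diamond] = −vol C_◇`,
`[complete star] = vol C_{K₄}`) and `B₂ = 2π/3`:
*`B₄/B₂³ = 2707/4480 + (219/2240)(√2/π) − (4131/4480)(arccos(1/3)/π)`* (`= 0.28695…`).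
Grounds `Summit.KontsevichZagierPeriods.KontsevichZagierPeriods.Theses.HardSphereVirial.StarFourSphere`
(value side; the item's KZ-derivability claim is not in print). [cite: Lyberg2005, §1 (Mayer form of B₄, hard-sphere f, B₂, and 'Boltzmann's result' for B₄/B₂³, confirmed by Nijboer–van Hove)] [cite: ClisbyMccoy2004, §1 (B₄/B₂³ for D = 3 in the arctan √2 form)] -/
def Boltzmann1899_B4_hardSpheres_dim3 : Prop :=
  (-(1 / 8 : ℝ) * (volume hardSphereStarFour).toReal
      + (3 / 4 : ℝ) * (volume hardSphereDiamondFour).toReal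
      - (3 / 8 : ℝ) * (volume hardSphereRingFour).toReal) / (2 * Real.pi / 3) ^ 3
    = 2707 / 4480 + (219 / 2240) * (Real.sqrt 2 / Real.pi)
      - (4131 / 4480) * (Real.arccos (1 / 3) / Real.pi)

/-- Unfolding lemma. [folklore] -/
theorem Boltzmann1899_B4_hardSpheres_dim3_iff :
    Boltzmann1899_B4_hardSpheres_dim3 ↔
      (-(1 / 8 : ℝ) * (volume hardSphereStarFour).toReal
          + (3 / 4 : ℝ) * (volume hardSphereDiamondFour).toReal
          - (3 / 8 : ℝ) * (volume hardSphereRingFour).toReal) / (2 * Real.pi / 3) ^ 3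
        = 2707 / 4480 + (219 / 2240) * (Real.sqrt 2 / Real.pi)
          - (4131 / 4480) * (Real.arccos (1 / 3) / Real.pi) :=
  Iff.rfl

/-- **The two printed forms agree**: Clisby–McCoy's `arctan √2` form of the `D = 3` value equals
Boltzmann's `arccos(1/3)` form, because `arccos(1/3) = π − 2·arctan √2`
(`cos(2 arctan √2) = (1 − 2)/(1 + 2) = −1/3`). Stated as the real-number identity between the
two right-hand sides, conditional on that angle identity (proved below from Mathlib).
[cite: ClisbyMccoy2004, §1] -/
theorem B4_dim3_arctan_form_eq (h : Real.arccos (1 / 3) = Real.pi - 2 * Real.arctan (Real.sqrt 2)) :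
    (2707 / 4480 + (219 / 2240) * (Real.sqrt 2 / Real.pi)
        - (4131 / 4480) * (Real.arccos (1 / 3) / Real.pi) : ℝ)
      = 219 * Real.sqrt 2 / (2240 * Real.pi) - 89 / 280
        + 4131 / (2240 * Real.pi) * Real.arctan (Real.sqrt 2) := by
  rw [h]
  have hπ : Real.pi ≠ 0 := Real.pi_ne_zero
  field_simp
  ring

/-- `arccos(1/3) = π − 2·arctan √2` (half-angle: `cos(2·arctan √2) = −1/3`). [folklore] -/
theorem arccos_one_third_eq : Real.arccos (1 / 3) = Real.pi - 2 * Real.arctan (Real.sqrt 2) := by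
  have h2 : Real.sqrt 2 ^ 2 = 2 := Real.sq_sqrt (by norm_num)
  have hcos : Real.cos (2 * Real.arctan (Real.sqrt 2)) = -(1 / 3 : ℝ) := by
    rw [Real.cos_two_mul, Real.cos_arctan]
    have h3 : (1 : ℝ) + Real.sqrt 2 ^ 2 = 3 := by rw [h2]; norm_num
    rw [h3]
    have hs : Real.sqrt 3 ≠ 0 := by positivity
    have hs2 : Real.sqrt 3 ^ 2 = 3 := Real.sq_sqrt (by norm_num)
    field_simp
    nlinarith [hs2]
  have hlo : 0 ≤ Real.pi - 2 * Real.arctan (Real.sqrt 2) := by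
    have := Real.arctan_lt_pi_div_two (Real.sqrt 2)
    linarith
  have hhi : Real.pi - 2 * Real.arctan (Real.sqrt 2) ≤ Real.pi := by
    have : 0 ≤ Real.arctan (Real.sqrt 2) := by
      have hm := Real.arctan_strictMono.monotone (Real.sqrt_nonneg 2)
      rwa [Real.arctan_zero] at hm
    linarith
  have hcos' : Real.cos (Real.pi - 2 * Real.arctan (Real.sqrt 2)) = 1 / 3 := by
    rw [Real.cos_pi_sub, hcos]; ring
  rw [← hcos', Real.arccos_cos hlo hhi]

end Literature.MathematicalPhysics.StatisticalMechanics

end
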